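import Summits.QuantumFields.YangMills.Theses.DirichletWindow
import Summits.QuantumFields.YangMills.Theorems.DirichletWindowAllSidesChessboardCouplingField
import Summits.QuantumFields.YangMills.Theorems.DirichletWindowAllSidesChessboardOddTorusEstimate
import Summits.QuantumFields.YangMills.Theorems.DirichletWindowAllSidesChessboardEvenTorusEstimate
import HarnessLib

/-!
# `DirichletWindow.AllSidesCouplingChessboard` (item stmt-QuantumFields-20194, K1 of the large-field sparsity line)

The COUPLING-FIELD CHESSBOARD ON TORI OF EVERY SIDE: for every `d`, every compact `G` with a unitary lattice
representation `r`, every side `L + 2 ≥ 2` (odd included), `0 ≤ κm ≤ β`, every plaquette-dependent coupling field `κ`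
with `κm ≤ κ ≤ β` and `κ = β` off a finite set `Z'`:

  `Z(κ) · Z(β)^{#Z'/(L+2)^d} ≤ Z(β) · Z(κm)^{#Z'/(L+2)^d}`,  `Z(c) = ∫ exp(-∑_p c_p (N - Re tr ρ U_p)) ∏_e dU_e`.

Proof (seat ym-dw-p1 g3): `Z` is antitone in the coupling field, so `Z(κ) ≤ Z(κ̃)` with `κ̃` two-valued (`κm` on
`Z'`, `β` elsewhere), and `Z(κ̃)/Z(β) = ⟨exp((β - κm) ∑_{q ∈ Z'} φ_q)⟩_β` is a Chebyshev functional of a plaquette set of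
ARBITRARY orientations; the multi-orientation chessboard estimate
`⟨exp(c ∑_{q ∈ P} φ_q)⟩_β ≤ ⟨exp(c ∑_{all q} φ_q)⟩_β ^ (#P / n^d)` (`0 ≤ c ≤ β`) holds on ODD tori
(`wilsonExpectation_expObs_le_rpow_all_odd`: twisted two-class Fröhlich–Israel–Lieb–Simon maximisation over the
tree's odd Osterwalder–Seiler reflection positivity with cut and shared weights) and on EVEN tori
(`wilsonExpectation_expObs_le_rpow_all_even`: the same with the link AND the site reflections, cut weights on the link
planes, shared weights on the site planes); `⟨exp(c ∑_{all q} φ_q)⟩_β = Z(β - c)/Z(β)` closes the algebra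
(`lintegral_couplingField_chessboard_of_expObs`).  The empty `Z'` (in particular `d ≤ 1`) is the trivial equality.

This is the Fröhlich–Lieb transfer-matrix chessboard (CMP 60 (1978) Thm. 2.2/2.3) in reflection-positivity form; it is
`G`-agnostic finite-torus bookkeeping.  With the landed `SparsityOfChessboard` and `CouplingReductionCost` it yields
`LargeFieldSparsityAllTori` (item stmt-QuantumFields-20162).  HONEST FRAMING: nothing here bears on the Yang–Mills mass
gap; no infinite-volume or continuum statement is made.
-/

noncomputable section

open MeasureTheory Finset
open Literature.MathematicalPhysics.QuantumFieldTheory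

namespace Summit.QuantumFields.YangMills.Theorems

open AllSidesChessboard

/-- **K1 — the coupling-field chessboard on tori of every side** (item stmt-QuantumFields-20194). -/
theorem allSidesCouplingChessboard_proof :
    Summit.QuantumFields.YangMills.Theses.DirichletWindow.AllSidesCouplingChessboard := by
  intro d G _ _ _ _ _ _ r L β κm hκm hκmβ κ Z' hκ hoff
  dsimp only
  haveI : NeZero (L + 2) := ⟨by omega⟩
  by_cases hZ : Z' = ∅
  · -- no exceptional plaquette: `κ ≡ β` and both sides agree
    subst hZ
    have hκβ : κ = fun _ => β := funext fun p => hoff p (Finset.notMem_empty p)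
    subst hκβ
    simp only [Finset.card_empty, Nat.cast_zero, zero_div, Real.rpow_zero, mul_one, le_refl]
  · -- a plaquette exists, so `d ≠ 0`
    obtain ⟨q, -⟩ := Finset.nonempty_iff_ne_empty.2 hZ
    haveI : NeZero d := ⟨by
      intro hd
      subst hd
      exact (Fin.elim0 q.2.1.1 : False)⟩
    refine lintegral_couplingField_chessboard_of_expObs r.ρ r.continuous (fun β' c hc hcβ' P => ?_) hκm hκmβ κ Z'
      hκ hoff
    rcases Nat.even_or_odd (L + 2) with hE | hO
    · exact wilsonExpectation_expObs_le_rpow_all_even r.ρ hE r.continuous hc hcβ' P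
    · exact wilsonExpectation_expObs_le_rpow_all_odd r.ρ hO (by obtain ⟨m, hm⟩ := hO; omega) r.continuous hc hcβ' P

end Summit.QuantumFields.YangMills.Theorems

end
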